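import Mathlib
import Summits.Ventures.HodgeRepro.Tier4.Line4.TailSeesawArch
import Summits.Ventures.HodgeRepro.Tier4.Line4.TailSeesawSparse

/-!
# Tier4/Line4/TailSeesawFull — C-L4-7B-ASSEMBLY at the plane of record with the archimedean test AND the sparsity
scale by name: the (7b) display body modulo the displays and `ChainInputs` only

Blind re-derivation cell `pub-hodge-repro`, Tier 4 «prove the step» (README §9–§10), seat t4-L2-p2 (gen 5; C-L4-7B-ASSEMBLY
S15841).  Tree path `lean/Summits/Ventures/HodgeRepro/Tier4/Line4/TailSeesawFull.lean`.  Imports this seat's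
`Line4/TailSeesawArch` (`tailForArch_body_of_pieces_archApprox`) and `Line4/TailSeesawSparse` (`exists_sparsityScale_plain`);
through them L4-p2's `isGenuineRow_seesawPlane`.  Mathlib-level; no literature; no `def`.

**`tailForArch_seesaw_of_pieces_full`**: on `(mixedRow q (a 0) (a 2)).withTransportedTorus g g' hgg' hg'g hgΩ`
(= `seesawPlane …` by `rfl`), the body of display (7b) from the pieces, with `hgen` (`isGenuineRow_seesawPlane`), the
archimedean test and `harch` (ARCHAPPROX, through the K-type data `D`) and (S-SPARSE) (`exists_sparsityScale_plain`) BY NAME.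
THE RESIDUAL (the (7b) census at this layer): `ht`, `hdet`, the two `CompactSpace` instances, the Haar normalisations, the
`Z(k)`-domain `DZf hDZf hfd hDZc`, the level prime `p hp hγ₀`, the (F) pieces `u κ hκ hproj M₃ hM₃ hcur` (all levels — the
threshold form through `exists_pieces_of_threshold`), (S-COUNT) `hcount`, (S-FIN-NV) `hnv`, the K-type data `D`, and
`ChainInputs` for every admissible `(finf, e)` (`hchain`).

Nothing here says anything about the status of the Hodge conjecture for CM abelian varieties, which is NOT proved
(HC_CM is NOT proved by anyone in this repository).
-/

set_option autoImplicit false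

noncomputable section

namespace Summit.Ventures.HodgeRepro.Tier4.Line4

open Matrix MeasureTheory Topology Filter NumberField IsDedekindDomain Summit.Ventures.HodgeRepro.Tier4
  Summit.Ventures.HodgeRepro.Tier4.Common Summit.Ventures.HodgeRepro.Tier4.Line1
  Summit.Ventures.HodgeRepro.Tier4.Line1.RTF Summit.Ventures.HodgeRepro.Tier4.Line4.L1Class

open scoped NumberField NNReal ENNReal Pointwise Matrix

section Full

variable {k : Type} [Field k] [NumberField k]

/-- **The (7b) display body at the plane of record, the test and the sparsity scale by name.** -/
theorem tailForArch_seesaw_of_pieces_full (q : QuadData k) (ht : q.t = 0) (hn : ¬ IsSquare (-q.n))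
    (a : Fin 4 → k) (ha : ∀ i, a i ≠ 0)
    (g g' : Matrix (Fin 4) (Fin 4) k) (hgg' : g * g' = 1) (hg'g : g' * g = 1)
    (hgΩ : g * (PlaneData.mixedRow q (a 0) (a 2)).Ω = (PlaneData.mixedRow q (a 0) (a 2)).Ω * g)
    (lam : k) (hlam : lam ≠ 0)
    (hiso : g * (PlaneData.mixedRow q (a 1) (a 3)).B * gᵀ = lam • (PlaneData.mixedRow q (a 0) (a 2)).B)
    (hdet : (((PlaneData.mixedRow q (a 0) (a 2)).withTransportedTorus g g' hgg' hg'g hgΩ)).B.det ≠ 0)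
    [MeasurableSpace (GA ((PlaneData.mixedRow q (a 0) (a 2)).withTransportedTorus g g' hgg' hg'g hgΩ))] [BorelSpace (GA ((PlaneData.mixedRow q (a 0) (a 2)).withTransportedTorus g g' hgg' hg'g hgΩ))] [MeasurableMul (torusT ((PlaneData.mixedRow q (a 0) (a 2)).withTransportedTorus g g' hgg' hg'g hgΩ))] [MeasurableMul (torusT' ((PlaneData.mixedRow q (a 0) (a 2)).withTransportedTorus g g' hgg' hg'g hgΩ))]
    (R : RTFData ((PlaneData.mixedRow q (a 0) (a 2)).withTransportedTorus g g' hgg' hg'g hgΩ)) (hRH : R.IsHaar)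
    (hc : Continuous R.chi) (hu : ∀ a, ‖R.chi a‖ = 1) (hc' : Continuous R.chi') (hu' : ∀ a, ‖R.chi' a‖ = 1)
    (w₀ : InfinitePlace k) (eP eM eP' eM' : InfinitePlace k → ℤ)
    (D : KTypeData ((PlaneData.mixedRow q (a 0) (a 2)).withTransportedTorus g g' hgg' hg'g hgΩ) R q g g' eP eM eP' eM')
    [R.μT.IsHaarMeasure] [R.μT'.IsHaarMeasure]
    (μ : Measure (GA ((PlaneData.mixedRow q (a 0) (a 2)).withTransportedTorus g g' hgg' hg'g hgΩ))) [μ.IsHaarMeasure] (DG : Set (GA ((PlaneData.mixedRow q (a 0) (a 2)).withTransportedTorus g g' hgg' hg'g hgΩ))) (fdG : IsFundamentalDomain (rationalPoints ((PlaneData.mixedRow q (a 0) (a 2)).withTransportedTorus g g' hgg' hg'g hgΩ)) DG μ)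
    (compG : IsCompact (closure DG)) (compT : IsCompact (closure R.DT)) (compT' : IsCompact (closure R.DT'))
    (γ₀ : rationalPoints ((PlaneData.mixedRow q (a 0) (a 2)).withTransportedTorus g g' hgg' hg'g hgΩ)) (hlin : IsLinRegular ((PlaneData.mixedRow q (a 0) (a 2)).withTransportedTorus g g' hgg' hg'g hgΩ) γ₀)
    (νinf : Measure (torusInf ((PlaneData.mixedRow q (a 0) (a 2)).withTransportedTorus g g' hgg' hg'g hgΩ))) [νinf.IsHaarMeasure] [CompactSpace (torusInf ((PlaneData.mixedRow q (a 0) (a 2)).withTransportedTorus g g' hgg' hg'g hgΩ))]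
    (νf : Measure (torusFin ((PlaneData.mixedRow q (a 0) (a 2)).withTransportedTorus g g' hgg' hg'g hgΩ))) [νf.IsHaarMeasure]
    (c : ℝ≥0) (hc0 : 0 < c) (hcμ : R.μT = c • Measure.map (torusSplit ((PlaneData.mixedRow q (a 0) (a 2)).withTransportedTorus g g' hgg' hg'g hgΩ)).symm (νinf.prod νf))
    (νinf' : Measure (torusInf' ((PlaneData.mixedRow q (a 0) (a 2)).withTransportedTorus g g' hgg' hg'g hgΩ))) [νinf'.IsHaarMeasure] [CompactSpace (torusInf' ((PlaneData.mixedRow q (a 0) (a 2)).withTransportedTorus g g' hgg' hg'g hgΩ))]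
    (νf' : Measure (torusFin' ((PlaneData.mixedRow q (a 0) (a 2)).withTransportedTorus g g' hgg' hg'g hgΩ))) [νf'.IsHaarMeasure]
    (c' : ℝ≥0) (hc0' : 0 < c') (hcμ' : R.μT' = c' • Measure.map (torusSplit' ((PlaneData.mixedRow q (a 0) (a 2)).withTransportedTorus g g' hgg' hg'g hgΩ)).symm (νinf'.prod νf'))
    (DZf : Set (torusFin ((PlaneData.mixedRow q (a 0) (a 2)).withTransportedTorus g g' hgg' hg'g hgΩ))) (hDZf : MeasurableSet DZf) (hfd : IsFundamentalDomain (centreFin ((PlaneData.mixedRow q (a 0) (a 2)).withTransportedTorus g g' hgg' hg'g hgΩ)) DZf νf)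
    (hDZc : ∀ C : Set (torusFin ((PlaneData.mixedRow q (a 0) (a 2)).withTransportedTorus g g' hgg' hg'g hgΩ)), IsCompact C → IsCompact (closure (DZf ∩ (C * (ZfIn ((PlaneData.mixedRow q (a 0) (a 2)).withTransportedTorus g g' hgg' hg'g hgΩ) : Set (torusFin ((PlaneData.mixedRow q (a 0) (a 2)).withTransportedTorus g g' hgg' hg'g hgΩ)))))))
    (μinf : Measure (infinitePart ((PlaneData.mixedRow q (a 0) (a 2)).withTransportedTorus g g' hgg' hg'g hgΩ))) [μinf.IsHaarMeasure] (μ₀ : Measure (finitePart ((PlaneData.mixedRow q (a 0) (a 2)).withTransportedTorus g g' hgg' hg'g hgΩ))) [μ₀.IsHaarMeasure]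
    (c₀ : ℝ≥0) (hc₀ : 0 < c₀) (hcμ₀ : μ = c₀ • Measure.map (gaSplit ((PlaneData.mixedRow q (a 0) (a 2)).withTransportedTorus g g' hgg' hg'g hgΩ)).symm (μinf.prod μ₀))
    (p : ℕ) (hp : p.Prime)
    (hγ₀ : ∀ v : HeightOneSpectrum (𝓞 k), natSize k v p < 1 → ∀ i j : Fin 4,
      Valued.v (finPart k (GA.mat ((PlaneData.mixedRow q (a 0) (a 2)).withTransportedTorus g g' hgg' hg'g hgΩ) (γ₀ : GA ((PlaneData.mixedRow q (a 0) (a 2)).withTransportedTorus g g' hgg' hg'g hgΩ)) i j) v) ≤ 1 ∧ Valued.v (finPart k (GA.mat ((PlaneData.mixedRow q (a 0) (a 2)).withTransportedTorus g g' hgg' hg'g hgΩ) (γ₀ : GA ((PlaneData.mixedRow q (a 0) (a 2)).withTransportedTorus g g' hgg' hg'g hgΩ))⁻¹ i j) v) ≤ 1)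
    (u : ℕ → ℝ≥0∞) (κ : ℝ≥0∞) (hκ : κ ≠ ⊤)
    (hproj : ∀ (M : ℕ) (γ : GA ((PlaneData.mixedRow q (a 0) (a 2)).withTransportedTorus g g' hgg' hg'g hgΩ)), νf (finTf ((PlaneData.mixedRow q (a 0) (a 2)).withTransportedTorus g g' hgg' hg'g hgΩ) '' closure R.DT ∩ projSet ((PlaneData.mixedRow q (a 0) (a 2)).withTransportedTorus g g' hgg' hg'g hgΩ) (γ₀ : GA ((PlaneData.mixedRow q (a 0) (a 2)).withTransportedTorus g g' hgg' hg'g hgΩ)) (p ^ M) γ) ≤ κ * u M)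
    (M₃ : ℝ≥0∞) (hM₃ : M₃ ≠ ⊤)
    (hcur : ∀ M, u M ≤ M₃ * νf (((ZfIn ((PlaneData.mixedRow q (a 0) (a 2)).withTransportedTorus g g' hgg' hg'g hgΩ) : Set (torusFin ((PlaneData.mixedRow q (a 0) (a 2)).withTransportedTorus g g' hgg' hg'g hgΩ))) ∩ levelTf ((PlaneData.mixedRow q (a 0) (a 2)).withTransportedTorus g g' hgg' hg'g hgΩ) 1) * levelTf ((PlaneData.mixedRow q (a 0) (a 2)).withTransportedTorus g g' hgg' hg'g hgΩ) (p ^ M)))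
    (hcount : SublevelCount₀ ((PlaneData.mixedRow q (a 0) (a 2)).withTransportedTorus g g' hgg' hg'g hgΩ) (Setting.ofAdelicData ((PlaneData.mixedRow q (a 0) (a 2)).withTransportedTorus g g' hgg' hg'g hgΩ) R μ DG fdG compG compT compT'))
    (hnv : ∃ δ : ℝ, 0 < δ ∧ ∃ M₀ : ℕ, ∀ M ≥ M₀,
      δ * (suppMeasure ((PlaneData.mixedRow q (a 0) (a 2)).withTransportedTorus g g' hgg' hg'g hgΩ) νf νf' (γ₀ : GA ((PlaneData.mixedRow q (a 0) (a 2)).withTransportedTorus g g' hgg' hg'g hgΩ)) DZf (p ^ M) (γ₀ : GA ((PlaneData.mixedRow q (a 0) (a 2)).withTransportedTorus g g' hgg' hg'g hgΩ))).toReal ≤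
        ‖∫ b in DZf, R.chi b * innerFin ((PlaneData.mixedRow q (a 0) (a 2)).withTransportedTorus g g' hgg' hg'g hgΩ) R (levelDC ((PlaneData.mixedRow q (a 0) (a 2)).withTransportedTorus g g' hgg' hg'g hgΩ) (γ₀ : GA ((PlaneData.mixedRow q (a 0) (a 2)).withTransportedTorus g g' hgg' hg'g hgΩ)) (p ^ M)) (γ₀ : GA ((PlaneData.mixedRow q (a 0) (a 2)).withTransportedTorus g g' hgg' hg'g hgΩ)) νf' b ∂νf‖)
    -- `ChainInputs` for every admissible `(finf, e)`
    (hchain : ∀ finf : GA ((PlaneData.mixedRow q (a 0) (a 2)).withTransportedTorus g g' hgg' hg'g hgΩ) → ℂ,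
      IsArchCoeffD ((PlaneData.mixedRow q (a 0) (a 2)).withTransportedTorus g g' hgg' hg'g hgΩ) (Setting.ofAdelicData ((PlaneData.mixedRow q (a 0) (a 2)).withTransportedTorus g g' hgg' hg'g hgΩ) R μ DG fdG compG compT compT') R q g g' w₀ eP eM eP' eM'
        (γ₀ : GA ((PlaneData.mixedRow q (a 0) (a 2)).withTransportedTorus g g' hgg' hg'g hgΩ)) νinf νinf' finf →
      ∀ e : GA ((PlaneData.mixedRow q (a 0) (a 2)).withTransportedTorus g g' hgg' hg'g hgΩ) → ℂ, IsInfFactor ((PlaneData.mixedRow q (a 0) (a 2)).withTransportedTorus g g' hgg' hg'g hgΩ) e →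
        (∀ (w : InfinitePlace k) (κ : GA ((PlaneData.mixedRow q (a 0) (a 2)).withTransportedTorus g g' hgg' hg'g hgΩ)), κ ∈ localTorusAt' ((PlaneData.mixedRow q (a 0) (a 2)).withTransportedTorus g g' hgg' hg'g hgΩ) w → ∀ x,
          e (x * κ) = weightAt' ((PlaneData.mixedRow q (a 0) (a 2)).withTransportedTorus g g' hgg' hg'g hgΩ) q w g g' 0 κ ^ (-eP' w) * weightAt' ((PlaneData.mixedRow q (a 0) (a 2)).withTransportedTorus g g' hgg' hg'g hgΩ) q w g g' 1 κ ^ (-eM' w) * e x) →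
        L1Class.archFactor ((PlaneData.mixedRow q (a 0) (a 2)).withTransportedTorus g g' hgg' hg'g hgΩ) R (convInf ((PlaneData.mixedRow q (a 0) (a 2)).withTransportedTorus g g' hgg' hg'g hgΩ) μinf finf e) (γ₀ : GA ((PlaneData.mixedRow q (a 0) (a 2)).withTransportedTorus g g' hgg' hg'g hgΩ)) νinf νinf' ≠ 0 →
        ∀ M : ℕ, ChainInputs ((PlaneData.mixedRow q (a 0) (a 2)).withTransportedTorus g g' hgg' hg'g hgΩ) R γ₀ νinf νf νinf' νf' DZf
          ((Setting.ofAdelicData ((PlaneData.mixedRow q (a 0) (a 2)).withTransportedTorus g g' hgg' hg'g hgΩ) R μ DG fdG compG compT compT').conv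
            (prodFn ((PlaneData.mixedRow q (a 0) (a 2)).withTransportedTorus g g' hgg' hg'g hgΩ) finf (ffinMu ((PlaneData.mixedRow q (a 0) (a 2)).withTransportedTorus g g' hgg' hg'g hgΩ) μ₀ (γ₀ : GA ((PlaneData.mixedRow q (a 0) (a 2)).withTransportedTorus g g' hgg' hg'g hgΩ)) (p ^ M))) (testNat ((PlaneData.mixedRow q (a 0) (a 2)).withTransportedTorus g g' hgg' hg'g hgΩ) e (p ^ M)))
          (fun x => (c₀ : ℂ) * convInf ((PlaneData.mixedRow q (a 0) (a 2)).withTransportedTorus g g' hgg' hg'g hgΩ) μinf finf e x) (levelDC ((PlaneData.mixedRow q (a 0) (a 2)).withTransportedTorus g g' hgg' hg'g hgΩ) (γ₀ : GA ((PlaneData.mixedRow q (a 0) (a 2)).withTransportedTorus g g' hgg' hg'g hgΩ)) (p ^ M))) :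
    ∀ finf : GA ((PlaneData.mixedRow q (a 0) (a 2)).withTransportedTorus g g' hgg' hg'g hgΩ) → ℂ,
      IsArchCoeffD ((PlaneData.mixedRow q (a 0) (a 2)).withTransportedTorus g g' hgg' hg'g hgΩ) (Setting.ofAdelicData ((PlaneData.mixedRow q (a 0) (a 2)).withTransportedTorus g g' hgg' hg'g hgΩ) R μ DG fdG compG compT compT') R q g g' w₀ eP eM eP' eM'
        (γ₀ : GA ((PlaneData.mixedRow q (a 0) (a 2)).withTransportedTorus g g' hgg' hg'g hgΩ)) νinf νinf' finf →
      ∃ lev : ℕ → ℕ, (∀ n, lev n ≠ 0) ∧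
      ∃ ffin f₂ : ℕ → GA ((PlaneData.mixedRow q (a 0) (a 2)).withTransportedTorus g g' hgg' hg'g hgΩ) → ℂ, TailFamily' ((PlaneData.mixedRow q (a 0) (a 2)).withTransportedTorus g g' hgg' hg'g hgΩ) q g g' eP' eM' (γ₀ : GA ((PlaneData.mixedRow q (a 0) (a 2)).withTransportedTorus g g' hgg' hg'g hgΩ)) ffin f₂ ∧
        ∃ E : Finset (Setting.ofAdelicData ((PlaneData.mixedRow q (a 0) (a 2)).withTransportedTorus g g' hgg' hg'g hgΩ) R μ DG fdG compG compT compT').Orbit,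
          (Setting.ofAdelicData ((PlaneData.mixedRow q (a 0) (a 2)).withTransportedTorus g g' hgg' hg'g hgΩ) R μ DG fdG compG compT compT').orbitOf γ₀ ∈ E ∧
          FibreDominatedFrom (Setting.ofAdelicData ((PlaneData.mixedRow q (a 0) (a 2)).withTransportedTorus g g' hgg' hg'g hgΩ) R μ DG fdG compG compT compT') R.chi R.chi' E
            (fun n => (Setting.ofAdelicData ((PlaneData.mixedRow q (a 0) (a 2)).withTransportedTorus g g' hgg' hg'g hgΩ) R μ DG fdG compG compT compT').conv
              (prodFn ((PlaneData.mixedRow q (a 0) (a 2)).withTransportedTorus g g' hgg' hg'g hgΩ) finf (ffin (lev n))) (f₂ (lev n))) := by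
  have hgen : IsGenuineRow ((PlaneData.mixedRow q (a 0) (a 2)).withTransportedTorus g g' hgg' hg'g hgΩ) := isGenuineRow_seesawPlane q ht hn a (ha 0) (ha 2) g g' hgg' hg'g hgΩ lam hlam hiso
  refine tailForArch_body_of_pieces_archApprox ((PlaneData.mixedRow q (a 0) (a 2)).withTransportedTorus g g' hgg' hg'g hgΩ) R μ DG fdG compG compT compT' hRH hc hu hc' hu' q g g' w₀ eP eM
    eP' eM' D hdet hgen γ₀ hlin νinf νf c hc0 hcμ νinf' νf' c' hc0' hcμ' DZf hDZf hfd hDZc μinf μ₀ c₀ hc₀ hcμ₀ p hp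
    hγ₀ u κ hκ hproj M₃ hM₃ hcur hcount hnv ?_
  intro finf hfinf e he hequiv harch
  exact ⟨exists_sparsityScale_plain q ht hn a ha g g' hgg' hg'g hgΩ lam hlam hiso R μ DG fdG compG compT compT' hgen
    γ₀ hlin p hp μ₀ finf e, hchain finf hfinf e he hequiv harch⟩

end Full

end Summit.Ventures.HodgeRepro.Tier4.Line4

end
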